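import Mathlib
import Literature.Analysis.FluidPDE.Tao2016AveragedNS.ShiftSetCascadeFlows
import Literature.Analysis.FluidPDE.Tao2016AveragedNS.ShiftSetCascadeFlux
import Summits.NavierStokesRegularity.NavierStokesRegularity.Theorems.TaoLadderRungTwoFlatGappedFrontRobustBehindTailOn
import Summits.NavierStokesRegularity.NavierStokesRegularity.Theorems.TaoLadderRungTwoFlatGappedFrontRobustTailZoneOn
import Summits.NavierStokesRegularity.NavierStokesRegularity.Theorems.TaoLadderRungTwoFlatGappedFrontRobustStepTransferOn
import HarnessLib

/-!
# Certificate glue on a shift set `𝕊`, I: ALL-SHELL BOUNDS for an exact flow from a window certificate's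
  trapping clause and the two tail theorems (helper for item stmt-NavierStokesRegularity-22987
  `FlatGapCertificatesV2`, crux K_A♭ of route TaoLadderRungTwoFlat; cell harvest/h2-tao-ladder, p1 g13)

THE SETTING (format A♭, theory-1 §27 «FAT-Z» + T-29 analytic layer, with K_B♭ proved). A finite-window
certificate for the EXACT `𝕊`-lattice at scale ratio `1+ε₀` controls the window shells `k ∈ [-Kb, Ka]` of a
flow only while (i) the two EDGE shells `-Kb-1` (wake side) and `Ka+1` (quiet side) stay under prescribed
bounds and (ii) the window itself stays in the certified sup-box `|S_{i,k}| ≤ M_k`; it then returns STRICT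
window bounds `|S_{i,k}| < M_k` («trapping clause», hypothesis `htrap` below — what a validated integration
of the window system with interval-valued edge inputs delivers). The two tail theorems of p1 g11/g12 control
the infinitely many other shells GIVEN the window's own edge shells: the FROZEN WAKE
(`GappedFrontRobustOn.pseudoFlowOnShift_behind_tail`: every shell `j < -Kb` stays in an envelope `Zf_j` and
drifts by at most `c·8Cα(1+ε₀)^{5j/2}Ẑf_j²`) and the GAUSSIAN TAIL ZONE
(`GappedFrontRobustOn.pseudoFlowOnShift_tail_zone`: `|S_{i,K}| ≤ ν_K r / w_{K-1}` for `K ≥ Ka`, by the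
tail-energy induction on the cut shell — valid on two-way nearest-neighbour shift sets).

**`exact_flow_bounds`.** For an exact flow (`κ₁ = κ₂ = 0`, zero slack, energies `½S₀²` at start) on
`[0, s]`, `0 < s ≤ c`, from a state `S₀` in the weighted `r`-ball around a reference state `z` (window part
certified by `Core`, wake under `Zb`, quiet tail under `Za ≤ r/(4w)`), the three controls close up JOINTLY
by real induction on time over the finitely many window constraints (first-exit argument, as in
`TrappingWindowRungThreeTrappingBootstrap`): the window bounds are strict on `[0, s]`, the wake is frozen,
the quiet tail is Gaussian-small, and the energies are `½S²`. Every closing condition is a scalar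
inequality in the certificate data, listed as a hypothesis (monotone in the horizon, so asked at `c`).

HONEST FRAMING: a lemma about Tao-type MODEL lattice flows on a general nearest-neighbour slot-closed shift set
`𝕊 ∌ (1,1,1)` (Tao 2016 §4 Lemma 4.1 (4.5), (4.8)–(4.10); §6.2 Prop. 6.3 (viii)–(ix) shapes); the trapping
clause is a HYPOTHESIS (no certificate is produced here); nothing is a statement about the Navier–Stokes
equations.
-/

noncomputable section

-- the sub-problem namespace repeats the summit name by design (D-0017)
set_option linter.dupNamespace false

namespace Summit.NavierStokesRegularity.NavierStokesRegularity.Theorems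

open Set Filter Topology MeasureTheory intervalIntegral Literature.Analysis.FluidPDE
  Literature.Analysis.FluidPDE.TaoCascade
open Summit.NavierStokesRegularity.NavierStokesRegularity.Theorems.GappedFrontRobustOn

namespace CertificateGlueOn

variable {m : ℕ} {𝕊 : Finset (ℤ × ℤ × ℤ)}
variable {τ ε₀ : ℝ} {α : Fin m → Fin m → Fin m → ℤ × ℤ × ℤ → ℝ}
  {S₀ : Fin m → ℤ → ℝ} {S F : Fin m → ℤ → ℝ → ℝ}

/-! ### Exact flows: energies are `½S²`, the motion law holds with equality -/

/-- Along an EXACT flow (zero defects, zero slack, start energies `½S₀²`) the energies are `½S²`.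
[cite: Tao2016AveragedNS, §4 Lemma 4.1 (4.10) with (4.12)] -/
theorem exact_energy_eq (h : PseudoFlowOnShift 𝕊 τ ε₀ α 0 0 S₀ (fun i k => (1 / 2) * S₀ i k ^ 2)
    (fun _ _ => 0) S F) (i : Fin m) (k : ℤ) {u : ℝ} (hu : u ∈ Icc 0 τ) :
    F i k u = (1 / 2) * S i k u ^ 2 := by
  have h1 := h.defect_lower i k u hu
  have h2 := h.defect_upper i k u hu
  simp only [zero_mul, add_zero] at h2
  linarith

/-- Along an EXACT flow the one-sided derivative within `[0, τ]` IS the nonlinearity.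
[cite: Tao2016AveragedNS, §4 Lemma 4.1 (4.8) with (4.12)] -/
theorem exact_derivWithin_eq (h : PseudoFlowOnShift 𝕊 τ ε₀ α 0 0 S₀ (fun i k => (1 / 2) * S₀ i k ^ 2)
    (fun _ _ => 0) S F) (i : Fin m) (k : ℤ) {u : ℝ} (hu : u ∈ Icc 0 τ) :
    derivWithin (S i k) (Icc 0 τ) u = quadTermOn 𝕊 ε₀ α S i k u := by
  have h1 := h.motion i k u hu
  simp only [zero_mul, abs_nonpos_iff, sub_eq_zero] at h1
  exact h1

/-- Along an EXACT flow on `[0, τ]`, on every sub-window `[0, s]` the amplitudes have the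
nonlinearity as derivative within `[0, s]`. [cite: Tao2016AveragedNS, §4 Lemma 4.1 (4.8) with (4.12)] -/
theorem exact_hasDerivWithinAt (h : PseudoFlowOnShift 𝕊 τ ε₀ α 0 0 S₀ (fun i k => (1 / 2) * S₀ i k ^ 2)
    (fun _ _ => 0) S F) {s : ℝ} (hsτ : s ≤ τ) (i : Fin m) (k : ℤ) {u : ℝ}
    (hu : u ∈ Icc 0 s) :
    HasDerivWithinAt (S i k) (quadTermOn 𝕊 ε₀ α S i k u) (Icc 0 s) u := by
  have huτ : u ∈ Icc 0 τ := ⟨hu.1, hu.2.trans hsτ⟩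
  have hd : DifferentiableWithinAt ℝ (S i k) (Icc 0 τ) u :=
    (h.contDiffOn_S i k).differentiableOn one_ne_zero u huτ
  have h1 := hd.hasDerivWithinAt
  rw [exact_derivWithin_eq h i k huτ] at h1
  exact h1.mono (Icc_subset_Icc_right hsτ)

/-! ### The joint bootstrap -/

/-- **ALL-SHELL BOUNDS FOR AN EXACT FLOW FROM THE BALL** (see the module docstring). Shift set: nearest
neighbour, slot-closed, `(1,1,1) ∉ 𝕊`; table cancelling with row sums `≤ Cα`; `ε₀ > 0`. Window `[-Kb, Ka]`
(`Ka ≥ 1`) with sup bounds `M`, wake envelope `Zf` (`j ≤ -Kb`, `Zf ≥ Zmin > 0`, `M(-Kb) ≤ Zf(-Kb)`), reference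
wake envelope `Zb` with `Zb_j + r/w_j ≤ Zf_j/2`, frozen-wake closing condition at horizon `c`; weights
`w > 0` with (T1) from `Ka`, reference quiet-tail envelope `Za ≤ r/(4w)` beyond `Ka` and `4 w_{Ka}|z_{i,Ka}| ≤ r`
on the core, thin-tail / closing / slowness conditions of the tail zone from `Ka+1` at horizon `c`,
`M(Ka) ≤ ν(Ka) r/w(Ka-1)`; the certificate's interior clause `hinside` and trapping clause `htrap` (edge
inputs bounded by `Zf(-Kb-1)` and `ν(Ka+1) r/w(Ka)`). Conclusion for every exact flow on `[0,s]`,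
`0 < s ≤ c`, from `S₀` with `w_k|S₀ - z| ≤ r`, `Core z`, `|z_j| ≤ Zb_j` behind, `|z_k| ≤ Za_k` ahead: strict
window bounds, frozen wake with explicit drift, Gaussian quiet tail, energies `½S²`.
[cite: Tao2016AveragedNS, §4 Lemma 4.1 (4.5), (4.8)–(4.10) and §6.2 Prop. 6.3 (viii)–(ix) (statement shapes)] -/
theorem exact_flow_bounds (h𝕊 : IsNearestNeighbourSet 𝕊) (h𝕊c : IsSlotClosed 𝕊)
    (h111 : ((1 : ℤ), (1 : ℤ), (1 : ℤ)) ∉ 𝕊) (hε : 0 < ε₀) (hαc : IsCancellingCoeffOn 𝕊 α)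
    {Cα : ℝ} (hCα0 : 0 ≤ Cα) (hCα : ∀ i, ∑ i₁, ∑ i₂, ∑ μ ∈ 𝕊, |α i₁ i₂ i μ| ≤ Cα)
    -- window, weights, radius, horizon
    {Kb Ka : ℤ} (hKb : 0 ≤ Kb) (hKa : 1 ≤ Ka) {Core : (Fin m → ℤ → ℝ) → Prop} {M w : ℤ → ℝ}
    {r c : ℝ} (hr : 0 ≤ r) (hw : ∀ k, 0 < w k)
    -- wake side
    {Zb Zf : ℤ → ℝ} {Zmin : ℝ} (hZf : ∀ j, j ≤ -Kb → 0 < Zf j) (hZmin : 0 < Zmin)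
    (hZmin' : ∀ j, j < -Kb → Zmin ≤ Zf j) (hZbf : ∀ j, j < -Kb → Zb j + r / w j ≤ Zf j / 2)
    (hMZf : M (-Kb) ≤ Zf (-Kb))
    (hcloseB : ∀ j, j < -Kb →
      c * (8 * Cα * (1 + ε₀) ^ ((5 : ℝ) * j / 2) *
        max (Zf (j - 1)) (max (Zf j) (Zf (j + 1))) * max (Zf (j - 1)) (max (Zf j) (Zf (j + 1))) + 0) ≤
        Zf j / 2)
    -- quiet side
    {Za ν : ℤ → ℝ} {ϑ : ℝ}
    (hT1 : ∀ k : ℤ, Ka ≤ k → 2 * (1 + ε₀) ^ (k : ℝ) * w k ≤ w (k + 1))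
    (hZa : ∀ k : ℤ, Ka < k → 4 * (w k * Za k) ≤ r)
    (hcoreTop : ∀ z, Core z → ∀ i, 4 * (w Ka * |z i Ka|) ≤ r)
    (hthin : ∀ K : ℤ, Ka + 1 ≤ K →
      (1 + ε₀) ^ ((5 : ℝ) * K / 2) * r * w (K - 1) ≤ ϑ * w (K - 2) ^ 2)
    (hν : ∀ K : ℤ, Ka ≤ K → 0 ≤ ν K)
    (hcloseA : ∀ K : ℤ, Ka + 1 ≤ K →
      2 * (Real.sqrt 2 * Real.sqrt (4 / 3 * m * (25 / 32 + 0 * (1 + ε₀) ^ ((2 : ℝ) * K))) /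
          (2 * (1 + ε₀) ^ ((K - 1 : ℤ) : ℝ)) +
        coeffAbsOn (botShifts 𝕊) α * c * (ϑ / (1 + ε₀) ^ ((5 : ℝ) / 2)) * ν (K - 1) ^ 2) ≤ ν K)
    (hslowA : ∀ K : ℤ, Ka + 1 ≤ K →
      (1 + ε₀) ^ ((5 : ℝ) * (K - 1 : ℤ) / 2) * coeffAbsOn (botShifts 𝕊) α * c *
        (ν (K - 1) * r / w (K - 2)) ≤ 1 / 2)
    (hMν : M Ka ≤ ν Ka * r / w (Ka - 1))
    -- the certificate's interior and trapping clauses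
    (hinside : ∀ (z S₀ : Fin m → ℤ → ℝ), Core z →
      (∀ i k, -Kb ≤ k → k ≤ Ka → w k * |S₀ i k - z i k| ≤ r) → ∀ i k, -Kb ≤ k → k ≤ Ka → |S₀ i k| < M k)
    (htrap : ∀ (s : ℝ) (z : Fin m → ℤ → ℝ) (S : Fin m → ℤ → ℝ → ℝ), Core z → 0 < s → s ≤ c →
      (∀ i k, -Kb ≤ k → k ≤ Ka → w k * |S i k 0 - z i k| ≤ r) →
      (∀ i k, -Kb ≤ k → k ≤ Ka → ∀ u ∈ Icc 0 s,
        HasDerivWithinAt (S i k) (quadTermOn 𝕊 ε₀ α S i k u) (Icc 0 s) u) →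
      (∀ i, ContinuousOn (S i (-Kb - 1)) (Icc 0 s)) → (∀ i, ContinuousOn (S i (Ka + 1)) (Icc 0 s)) →
      (∀ i, ∀ u ∈ Icc 0 s, |S i (-Kb - 1) u| ≤ Zf (-Kb - 1)) →
      (∀ i, ∀ u ∈ Icc 0 s, |S i (Ka + 1) u| ≤ ν (Ka + 1) * r / w Ka) →
      (∀ i k, -Kb ≤ k → k ≤ Ka → ∀ u ∈ Icc 0 s, |S i k u| ≤ M k) →
        ∀ i k, -Kb ≤ k → k ≤ Ka → ∀ u ∈ Icc 0 s, |S i k u| < M k)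
    -- the start state and the flow
    {z : Fin m → ℤ → ℝ} (hzc : Core z) (hzb : ∀ i j, j < -Kb → |z i j| ≤ Zb j)
    (hza : ∀ i k, Ka < k → |z i k| ≤ Za k) (hball : ∀ i k, w k * |S₀ i k - z i k| ≤ r)
    {s : ℝ} (hs : 0 < s) (hsc : s ≤ c)
    (hflow : PseudoFlowOnShift 𝕊 s ε₀ α 0 0 S₀ (fun i k => (1 / 2) * S₀ i k ^ 2) (fun _ _ => 0) S F) :
    (∀ i k, -Kb ≤ k → k ≤ Ka → ∀ u ∈ Icc 0 s, |S i k u| < M k) ∧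
    (∀ (i : Fin m) (j : ℤ), j < -Kb → ∀ u ∈ Icc 0 s, |S i j u| ≤ Zf j ∧
      |S i j u - S₀ i j| ≤ c * (8 * Cα * (1 + ε₀) ^ ((5 : ℝ) * j / 2) *
        max (Zf (j - 1)) (max (Zf j) (Zf (j + 1))) * max (Zf (j - 1)) (max (Zf j) (Zf (j + 1))))) ∧
    (∀ K : ℤ, Ka ≤ K → ∀ u ∈ Icc 0 s, ∀ i, |S i K u| ≤ ν K * r / w (K - 1)) ∧
    (∀ i k, ∀ u ∈ Icc 0 s, F i k u = (1 / 2) * S i k u ^ 2) := by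
  have hq : 0 < 1 + ε₀ := by linarith
  -- energies, derivatives, continuity, start values
  have hFeq : ∀ i k, ∀ u ∈ Icc 0 s, F i k u = (1 / 2) * S i k u ^ 2 :=
    fun i k u hu => exact_energy_eq hflow i k hu
  have hderiv : ∀ {σ : ℝ}, σ ≤ s → ∀ i k, ∀ u ∈ Icc 0 σ,
      HasDerivWithinAt (S i k) (quadTermOn 𝕊 ε₀ α S i k u) (Icc 0 σ) u :=
    fun hσs i k u hu => exact_hasDerivWithinAt hflow hσs i k hu
  have hScont : ∀ i k, ContinuousOn (S i k) (Icc 0 s) := fun i k =>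
    (hflow.contDiffOn_S i k).continuousOn
  have hinit : ∀ i k, S i k 0 = S₀ i k := hflow.init_S
  have hball0 : ∀ i k, -Kb ≤ k → k ≤ Ka → w k * |S i k 0 - z i k| ≤ r := fun i k _ _ => by
    rw [hinit]; exact hball i k
  have h0win : ∀ i k, -Kb ≤ k → k ≤ Ka → |S i k 0| < M k := by
    intro i k h1 h2
    rw [hinit]
    exact hinside z S₀ hzc (fun i k _ _ => hball i k) i k h1 h2
  -- start values behind: |S₀| ≤ |z| + r/w ≤ Zb + r/w ≤ Zf/2
  have hS₀z : ∀ i k, |S₀ i k| ≤ |z i k| + r / w k := by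
    intro i k
    have h1 : |S₀ i k - z i k| ≤ r / w k := by
      rw [le_div_iff₀ (hw k), mul_comm]; exact hball i k
    calc |S₀ i k| = |(S₀ i k - z i k) + z i k| := by ring_nf
      _ ≤ |S₀ i k - z i k| + |z i k| := abs_add_le _ _
      _ ≤ |z i k| + r / w k := by linarith
  have h0beh : ∀ (i : Fin m) (j : ℤ), j < -Kb → |S₀ i j| ≤ Zf j / 2 := fun i j hj => by
    linarith [hS₀z i j, hzb i j hj, hZbf j hj]
  -- (T2) for the reference state from `Ka` on
  have hT2 : ∀ k : ℤ, Ka ≤ k → ∀ i, 4 * (w k * |z i k|) ≤ r := by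
    intro k hk i
    rcases eq_or_lt_of_le hk with heq | hlt
    · rw [← heq]; exact hcoreTop z hzc i
    · calc 4 * (w k * |z i k|) ≤ 4 * (w k * Za k) :=
          mul_le_mul_of_nonneg_left (mul_le_mul_of_nonneg_left (hza i k hlt) (hw k).le) (by norm_num)
        _ ≤ r := hZa k hlt
  -- BEHIND: weak window bound at the bottom shell on `[0,σ]` ⇒ frozen wake on `[0,σ]`
  have behind : ∀ σ, 0 < σ → σ ≤ s →
      (∀ i, ∀ u ∈ Icc 0 σ, |S i (-Kb) u| ≤ M (-Kb)) →
      ∀ (i : Fin m) (j : ℤ), j < -Kb → ∀ u ∈ Icc 0 σ, |S i j u| ≤ Zf j ∧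
        |S i j u - S₀ i j| ≤ σ * (8 * Cα * (1 + ε₀) ^ ((5 : ℝ) * j / 2) *
          max (Zf (j - 1)) (max (Zf j) (Zf (j + 1))) * max (Zf (j - 1)) (max (Zf j) (Zf (j + 1))) + 0) := by
    intro σ hσ hσs hbot
    have hwin : ∀ i, ∀ u ∈ Icc 0 σ, |S i (-Kb) u| ≤ Zf (-Kb) := fun i u hu => (hbot i u hu).trans hMZf
    have hδ : ∀ (i : Fin m) (j : ℤ), j < -Kb → ∀ u ∈ Icc 0 σ,
        0 * (1 + ε₀) ^ ((2 : ℝ) * j) * Real.sqrt (F i j u) ≤ (fun _ : ℤ => (0 : ℝ)) j := by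
      intro i j _ u _; simp
    have hcloseσ : ∀ j, j < -Kb →
        σ * (8 * Cα * (1 + ε₀) ^ ((5 : ℝ) * j / 2) *
          max (Zf (j - 1)) (max (Zf j) (Zf (j + 1))) * max (Zf (j - 1)) (max (Zf j) (Zf (j + 1))) +
            (fun _ : ℤ => (0 : ℝ)) j) ≤ Zf j / 2 := by
      intro j hj
      have hmx : 0 ≤ max (Zf (j - 1)) (max (Zf j) (Zf (j + 1))) :=
        le_trans (hZf j (by omega)).le ((le_max_left _ _).trans (le_max_right _ _))
      have hX : 0 ≤ 8 * Cα * (1 + ε₀) ^ ((5 : ℝ) * j / 2) *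
          max (Zf (j - 1)) (max (Zf j) (Zf (j + 1))) * max (Zf (j - 1)) (max (Zf j) (Zf (j + 1))) + 0 := by
        have := Real.rpow_pos_of_pos hq ((5 : ℝ) * j / 2); positivity
      calc σ * _ ≤ c * (8 * Cα * (1 + ε₀) ^ ((5 : ℝ) * j / 2) *
            max (Zf (j - 1)) (max (Zf j) (Zf (j + 1))) * max (Zf (j - 1)) (max (Zf j) (Zf (j + 1))) + 0) :=
            mul_le_mul_of_nonneg_right (hσs.trans hsc) hX
        _ ≤ Zf j / 2 := hcloseB j hj
    exact pseudoFlowOnShift_behind_tail h𝕊 hflow hε.le le_rfl hσ hσs hCα hZf hZmin hZmin' hwin h0beh hδ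
      hcloseσ
  -- AHEAD: weak window bound at the top shell on `[0,σ]` ⇒ Gaussian quiet tail on `[0,σ]`
  have ahead : ∀ σ, 0 < σ → σ ≤ s →
      (∀ i, ∀ u ∈ Icc 0 σ, |S i Ka u| ≤ M Ka) →
      ∀ K : ℤ, Ka ≤ K → ∀ u ∈ Icc 0 σ, ∀ i, |S i K u| ≤ ν K * r / w (K - 1) := by
    intro σ hσ hσs htop
    have hflowσ := pseudoFlowOnShift_mono hflow hσ hσs
    have hC0 : 0 ≤ coeffAbsOn (botShifts 𝕊) α := coeffAbsOn_nonneg _ _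
    have hB₀ : ∀ (i : Fin m) (k : ℤ), Ka ≤ k →
        (fun (_ : Fin m) (_ : ℤ) => (0 : ℝ)) i k ≤ 0 * (1 + ε₀) ^ ((2 : ℝ) * k) * r ^ 2 / w k ^ 2 := by
      intro i k _; simp
    have hcloseσ : ∀ K : ℤ, Ka + 1 ≤ K →
        2 * (Real.sqrt 2 * Real.sqrt (4 / 3 * m * (25 / 32 + 0 * (1 + ε₀) ^ ((2 : ℝ) * K))) /
            (2 * (1 + ε₀) ^ ((K - 1 : ℤ) : ℝ)) +
          coeffAbsOn (botShifts 𝕊) α * σ * (ϑ / (1 + ε₀) ^ ((5 : ℝ) / 2)) * ν (K - 1) ^ 2) ≤ ν K := by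
      intro K hK
      refine le_trans ?_ (hcloseA K hK)
      have hϑ : 0 ≤ ϑ := by
        -- from the thin-tail clause at `K` (all other factors positive)
        have h1 := hthin K hK
        have h2 : 0 < (1 + ε₀) ^ ((5 : ℝ) * K / 2) * r * w (K - 1) ∨
            (1 + ε₀) ^ ((5 : ℝ) * K / 2) * r * w (K - 1) = 0 := by
          rcases eq_or_lt_of_le hr with h0 | h0
          · right; rw [← h0]; ring
          · left; have := hw (K - 1); have := Real.rpow_pos_of_pos hq ((5 : ℝ) * K / 2); positivity
        have h3 : 0 < w (K - 2) ^ 2 := pow_pos (hw (K - 2)) 2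
        rcases h2 with h2 | h2
        · nlinarith
        · nlinarith
      have hfac : 0 ≤ coeffAbsOn (botShifts 𝕊) α * (ϑ / (1 + ε₀) ^ ((5 : ℝ) / 2)) * ν (K - 1) ^ 2 := by
        have := Real.rpow_pos_of_pos hq ((5 : ℝ) / 2); positivity
      have hmono : coeffAbsOn (botShifts 𝕊) α * σ * (ϑ / (1 + ε₀) ^ ((5 : ℝ) / 2)) * ν (K - 1) ^ 2 ≤
          coeffAbsOn (botShifts 𝕊) α * c * (ϑ / (1 + ε₀) ^ ((5 : ℝ) / 2)) * ν (K - 1) ^ 2 := by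
        have : coeffAbsOn (botShifts 𝕊) α * σ * (ϑ / (1 + ε₀) ^ ((5 : ℝ) / 2)) * ν (K - 1) ^ 2 =
            σ * (coeffAbsOn (botShifts 𝕊) α * (ϑ / (1 + ε₀) ^ ((5 : ℝ) / 2)) * ν (K - 1) ^ 2) := by ring
        rw [this, show coeffAbsOn (botShifts 𝕊) α * c * (ϑ / (1 + ε₀) ^ ((5 : ℝ) / 2)) * ν (K - 1) ^ 2 =
            c * (coeffAbsOn (botShifts 𝕊) α * (ϑ / (1 + ε₀) ^ ((5 : ℝ) / 2)) * ν (K - 1) ^ 2) by ring]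
        exact mul_le_mul_of_nonneg_right (hσs.trans hsc) hfac
      linarith
    have hslowσ : ∀ K : ℤ, Ka + 1 ≤ K →
        (1 + ε₀) ^ ((5 : ℝ) * (K - 1 : ℤ) / 2) * coeffAbsOn (botShifts 𝕊) α * σ *
          (ν (K - 1) * r / w (K - 2)) ≤ 1 / 2 := by
      intro K hK
      refine le_trans ?_ (hslowA K hK)
      have h1 : 0 ≤ (1 + ε₀) ^ ((5 : ℝ) * (K - 1 : ℤ) / 2) * coeffAbsOn (botShifts 𝕊) α :=
        mul_nonneg (Real.rpow_pos_of_pos hq _).le hC0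
      have h2 : 0 ≤ ν (K - 1) * r / w (K - 2) := by
        have := hν (K - 1) (by omega); have := hw (K - 2); positivity
      have : (1 + ε₀) ^ ((5 : ℝ) * (K - 1 : ℤ) / 2) * coeffAbsOn (botShifts 𝕊) α * σ *
          (ν (K - 1) * r / w (K - 2)) =
          σ * ((1 + ε₀) ^ ((5 : ℝ) * (K - 1 : ℤ) / 2) * coeffAbsOn (botShifts 𝕊) α *
            (ν (K - 1) * r / w (K - 2))) := by ring
      rw [this, show (1 + ε₀) ^ ((5 : ℝ) * (K - 1 : ℤ) / 2) * coeffAbsOn (botShifts 𝕊) α * c *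
          (ν (K - 1) * r / w (K - 2)) = c * ((1 + ε₀) ^ ((5 : ℝ) * (K - 1 : ℤ) / 2) *
            coeffAbsOn (botShifts 𝕊) α * (ν (K - 1) * r / w (K - 2))) by ring]
      exact mul_le_mul_of_nonneg_right (hσs.trans hsc) (mul_nonneg h1 h2)
    have hbase : ∀ u ∈ Icc 0 σ, ∀ i, |S i (Ka + 1 - 1) u| ≤ ν (Ka + 1 - 1) * r / w (Ka + 1 - 2) := by
      intro u hu i
      have e1 : Ka + 1 - 1 = Ka := by ring
      have e2 : Ka + 1 - 2 = Ka - 1 := by ring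
      rw [e1, e2]
      exact (htop i u hu).trans hMν
    have hνK : ∀ K : ℤ, Ka + 1 - 1 ≤ K → 0 ≤ ν K := fun K hK => hν K (by omega)
    have hz := pseudoFlowOnShift_tail_zone h𝕊 h𝕊c h111 hflowσ hσ hε hαc (w := w) (z := z) (r := r)
      (β := 0) (ϑ := ϑ) (k₁ := Ka) (k₂ := Ka + 1) (ν := ν) hr le_rfl hw hT1 hT2 hball hB₀ hthin
      (by omega) (by omega) hνK hcloseσ hslowσ hbase
    intro K hK u hu i
    exact hz K (by omega) u hu i
  -- KEY: weak window bounds on `[0,σ]` are strict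
  have key : ∀ σ, 0 < σ → σ ≤ s →
      (∀ i k, -Kb ≤ k → k ≤ Ka → ∀ u ∈ Icc 0 σ, |S i k u| ≤ M k) →
      ∀ i k, -Kb ≤ k → k ≤ Ka → ∀ u ∈ Icc 0 σ, |S i k u| < M k := by
    intro σ hσ hσs hweak
    have hKK : -Kb ≤ Ka := by omega
    have hbot : ∀ i, ∀ u ∈ Icc 0 σ, |S i (-Kb) u| ≤ M (-Kb) := fun i u hu =>
      hweak i (-Kb) le_rfl hKK u hu
    have htop : ∀ i, ∀ u ∈ Icc 0 σ, |S i Ka u| ≤ M Ka := fun i u hu => hweak i Ka hKK le_rfl u hu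
    have hB := behind σ hσ hσs hbot
    have hA := ahead σ hσ hσs htop
    have hedgeB : ∀ i, ∀ u ∈ Icc 0 σ, |S i (-Kb - 1) u| ≤ Zf (-Kb - 1) := fun i u hu =>
      (hB i (-Kb - 1) (by omega) u hu).1
    have hedgeA : ∀ i, ∀ u ∈ Icc 0 σ, |S i (Ka + 1) u| ≤ ν (Ka + 1) * r / w Ka := by
      intro i u hu
      have := hA (Ka + 1) (by omega) u hu i
      rwa [show Ka + 1 - 1 = Ka by ring] at this
    have hcontB : ∀ i, ContinuousOn (S i (-Kb - 1)) (Icc 0 σ) := fun i =>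
      (hScont i (-Kb - 1)).mono (Icc_subset_Icc_right hσs)
    have hcontA : ∀ i, ContinuousOn (S i (Ka + 1)) (Icc 0 σ) := fun i =>
      (hScont i (Ka + 1)).mono (Icc_subset_Icc_right hσs)
    exact htrap σ z S hzc hσ (hσs.trans hsc) hball0 (fun i k _ _ u hu => hderiv hσs i k u hu) hcontB hcontA
      hedgeB hedgeA hweak
  -- REAL INDUCTION over the window constraints
  set T : Set ℝ := {σ | σ ∈ Icc (0 : ℝ) s ∧ ∀ i k, -Kb ≤ k → k ≤ Ka → |S i k σ| ≤ M k} with hT_def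
  have hT_sub : T ⊆ Icc 0 s := fun σ hσ => hσ.1
  have hT_closed : IsClosed (T ∩ Icc 0 s) := by
    rw [inter_eq_left.mpr hT_sub]
    have hT_eq : T = Icc (0 : ℝ) s ∩ ⋂ i : Fin m, ⋂ k : ℤ,
        {σ | σ ∈ Icc (0 : ℝ) s ∧ (-Kb ≤ k → k ≤ Ka → |S i k σ| ≤ M k)} := by
      ext σ
      simp only [hT_def, mem_setOf_eq, mem_inter_iff, mem_iInter]
      constructor
      · rintro ⟨h1, h2⟩
        exact ⟨h1, fun i k => ⟨h1, h2 i k⟩⟩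
      · rintro ⟨h1, h2⟩
        exact ⟨h1, fun i k => (h2 i k).2⟩
    rw [hT_eq]
    refine isClosed_Icc.inter (isClosed_iInter fun i => isClosed_iInter fun k => ?_)
    by_cases hk : -Kb ≤ k ∧ k ≤ Ka
    · have hset : {σ | σ ∈ Icc (0 : ℝ) s ∧ (-Kb ≤ k → k ≤ Ka → |S i k σ| ≤ M k)} =
          {σ ∈ Icc (0 : ℝ) s | |S i k σ| ≤ M k} := by
        ext σ
        simp only [mem_setOf_eq]
        exact ⟨fun h => ⟨h.1, h.2 hk.1 hk.2⟩, fun h => ⟨h.1, fun _ _ => h.2⟩⟩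
      rw [hset]
      exact isClosed_Icc.isClosed_le (hScont i k).abs continuousOn_const
    · have hset : {σ | σ ∈ Icc (0 : ℝ) s ∧ (-Kb ≤ k → k ≤ Ka → |S i k σ| ≤ M k)} = Icc 0 s := by
        ext σ
        simp only [mem_setOf_eq]
        exact ⟨fun h => h.1, fun h => ⟨h, fun h1 h2 => absurd ⟨h1, h2⟩ hk⟩⟩
      rw [hset]
      exact isClosed_Icc
  have h0T : (0 : ℝ) ∈ T := ⟨⟨le_rfl, hs.le⟩, fun i k h1 h2 => (h0win i k h1 h2).le⟩
  have hIcc : Icc 0 s ⊆ T := by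
    refine hT_closed.Icc_subset_of_forall_mem_nhdsGT_of_Icc_subset h0T fun t ht hts => ?_
    -- strict window bounds at time `t`
    have hstrict : ∀ i k, -Kb ≤ k → k ≤ Ka → |S i k t| < M k := by
      rcases ht.1.eq_or_lt with h0 | htpos
      · rw [← h0]
        exact h0win
      · have hweak : ∀ i k, -Kb ≤ k → k ≤ Ka → ∀ u ∈ Icc 0 t, |S i k u| ≤ M k :=
          fun i k h1 h2 u hu => (hts hu).2 i k h1 h2
        exact fun i k h1 h2 => key t htpos ht.2.le hweak i k h1 h2 t ⟨ht.1, le_rfl⟩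
    -- by continuity they persist on a right neighbourhood of `t`
    have hle : 𝓝[>] t ≤ 𝓝[Icc 0 s] t := by
      rw [← nhdsWithin_Ioo_eq_nhdsGT ht.2]
      exact nhdsWithin_mono _ fun x hx => ⟨ht.1.trans hx.1.le, hx.2.le⟩
    have hev : ∀ᶠ σ in 𝓝[>] t, ∀ i : Fin m, ∀ k ∈ Finset.Icc (-Kb) Ka, |S i k σ| < M k := by
      refine eventually_all.mpr fun i => (eventually_all_finset _).mpr fun k hk => ?_
      rw [Finset.mem_Icc] at hk
      have hcont : ContinuousWithinAt (S i k) (Icc 0 s) t :=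
        (hScont i k).continuousWithinAt ⟨ht.1, ht.2.le⟩
      exact ((hcont.tendsto.abs).eventually (gt_mem_nhds (hstrict i k hk.1 hk.2))).filter_mono hle
    filter_upwards [hev, Icc_mem_nhdsGT ht.2] with σ hσ hσ'
    exact ⟨⟨ht.1.trans hσ'.1, hσ'.2⟩, fun i k h1 h2 => (hσ i k (Finset.mem_Icc.mpr ⟨h1, h2⟩)).le⟩
  have hweak : ∀ i k, -Kb ≤ k → k ≤ Ka → ∀ u ∈ Icc 0 s, |S i k u| ≤ M k :=
    fun i k h1 h2 u hu => (hIcc hu).2 i k h1 h2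
  -- conclusions on the whole of `[0, s]`
  have hKK : -Kb ≤ Ka := by omega
  have hbot : ∀ i, ∀ u ∈ Icc 0 s, |S i (-Kb) u| ≤ M (-Kb) := fun i u hu =>
    hweak i (-Kb) le_rfl hKK u hu
  have htop : ∀ i, ∀ u ∈ Icc 0 s, |S i Ka u| ≤ M Ka := fun i u hu => hweak i Ka hKK le_rfl u hu
  refine ⟨key s hs le_rfl hweak, fun i j hj u hu => ?_, ahead s hs le_rfl htop, hFeq⟩
  obtain ⟨h1, h2⟩ := behind s hs le_rfl hbot i j hj u hu
  refine ⟨h1, h2.trans ?_⟩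
  have hmx : 0 ≤ max (Zf (j - 1)) (max (Zf j) (Zf (j + 1))) :=
    le_trans (hZf j (by omega)).le ((le_max_left _ _).trans (le_max_right _ _))
  have hX : 0 ≤ 8 * Cα * (1 + ε₀) ^ ((5 : ℝ) * j / 2) *
      max (Zf (j - 1)) (max (Zf j) (Zf (j + 1))) * max (Zf (j - 1)) (max (Zf j) (Zf (j + 1))) := by
    have := Real.rpow_pos_of_pos hq ((5 : ℝ) * j / 2); positivity
  rw [add_zero]
  exact mul_le_mul_of_nonneg_right hsc hX

end CertificateGlueOn

end Summit.NavierStokesRegularity.NavierStokesRegularity.Theorems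

end
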